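import Literature.MathematicalPhysics.QuantumFieldTheory.Balaban1983to89.B5Prop11Plancherel

/-!
# `Balaban1983to89.B5Eq129FreeResolventCycleWeightedTV` — T. Bałaban, *Propagators and renormalization transformations for lattice gauge
# theories. I*, Commun. Math. Phys. **95** (1984) 17–40 [Balaban1984PropagatorsI] (1.29) p. 23, p. 36 (exponential weights; here d = 1): **THE WEIGHTED
# TOTAL VARIATION OF A V-SHAPED PROFILE ON THE CYCLE `ℤ∕n` UNDER AN EVEN MAJORANT — `Σ_s φ(d_n(s))|H(s) − H(s−1)| ≤ S·[(φ0 + φ1)G(0) +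
# Σ_{1≤j<⌊n∕2⌋}(φ(j+1) − φ(j−1))G(j)]` for `0 ≤ H ≤ S·G`, `H`, `G` even, `H` non-increasing in `|s|`, `φ ≥ 0` monotone** (two Abel summations) — the
# 1-d core of the WEIGHTED ∇-row (P-J-1b) of the pub-balaban NE9 chain's storey J (row L13 of `t4/ROUTES-NE9.md`): t4-ne9-idea-1 g129's
# `weighted_row_core` steps (2)–(6) and `abel_desc_le`∕`abel_asc_le` (Mathlib-only scratch under FREEZE (0)), here in the tree; inputs supplied by
# `B5Eq129FreeResolventWeightedMarginal` (`H` = transversely weighted fibre sums), `…CycleComparison` + `…CycleProfile` (`G`, `S = Φ(0)`),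
# `…KernelMonotone` (monotonicity, evenness)

statement-level skeleton of published theorems with citation tags; proofs where landed; nothing here is a claim about the Yang–Mills mass gap

CITATION HEADER (lean-in-tree rule).  Audit cell `pub-balaban`, sub-cell `t4`, BINDER row NE9; filed by NE9 crux-team LEAF PROVER 05
(`b2b-balaban-t4-ne9-formalise-leaf-05`, gen 80).  OBJECT: profiles on `ZMod n` (the d = 1 fibre index of [Balaban1984PropagatorsI] (1.29)'s torus), all data
as HYPOTHESES (no `def`, no stencil).  CONTENT: [folklore] (Abel summation).  Mathematics and Lean text: t4-ne9-idea-1 g129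
`t4/ideate/NE9/lens1-g129/lean/PJ1Bcycle_g129.NOT-TO-FILE.lean` l.1030–1084, l.1460–1690 (credit; ported with `P ↦ n`, `K ↦ H`, the `η⁻¹` factor dropped).
Nothing of [B5′] is asserted.

WHAT IS PROVED (sorry-free; proof lane — 0 `def`).
* **`weighted_tv_le`** — the displayed inequality (`n ≥ 2`).
HONEST SCOPE.  Pure bookkeeping on the cycle; no kernel, no weight is fixed.  ONE step of ONE letter of ONE un-opened storey (J) of row L13; NOT the ∇-line of
(3.42), NOT Tier P, NOT NE9 (cell pub-balaban: NE9 NOT PRINTED ∕ NOT PROVED; «NE9 ⇐ the named binders»; row WALLED ON A MODEL (O-NE9-1; #5 UNRULED); spine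
PROVED 0∕9; rung (B)+1 finite T⁴ — NOT infinite volume, NOT mass gap, NOT BetaPertH, NOT Clay).  HONEST DEPENDENCY: continuum YM on T⁴ ⇐ BetaPertH ∧ nine
spine estimates (0/9 proved); BetaPertH ⇐ (D1) ∧ (D4) ∧ CAP+tail; G-an2-4 gates asym, D1 and NE2/3/4.  NEW file importing `B5Prop11Plancherel` only (Mathlib
closure); nothing modified.  Net new unproved facts: 0.
-/

noncomputable section

open scoped BigOperators

namespace Literature.MathematicalPhysics.QuantumFieldTheory.Balaban1983to89.B5Eq129FreeResolventCycleWeightedTV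

/-! ## §1 Abel summation on the two halves of a V (on `ℕ`) -/

/-- Descending half: `Σ_{t<m} f(t+1)(K t − K(t+1)) ≤ f 1·G 0 + Σ_{1≤t<m} (f(t+1) − f t)·G t` for `f ≥ 0` nondecreasing on `[1,m]`,
`0 ≤ K m`, `K ≤ G` on `[0,m)`. [folklore] -/
private theorem abel_desc_le (f K G : ℕ → ℝ) (m : ℕ) (hm : 1 ≤ m)
    (hf1 : 0 ≤ f 1) (hfm : 0 ≤ f m)
    (hfup : ∀ t, 1 ≤ t → t < m → f t ≤ f (t + 1))
    (hKm : 0 ≤ K m) (hKG : ∀ t, t < m → K t ≤ G t) :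
    ∑ t ∈ Finset.range m, f (t + 1) * (K t - K (t + 1))
      ≤ f 1 * G 0 + ∑ t ∈ Finset.Ico 1 m, (f (t + 1) - f t) * G t := by
  have key : ∀ n, 1 ≤ n → n ≤ m → ∑ t ∈ Finset.range n, f (t + 1) * (K t - K (t + 1))
      ≤ f 1 * G 0 + ∑ t ∈ Finset.Ico 1 n, (f (t + 1) - f t) * G t - f n * K n := by
    intro n hn hnm
    induction n, hn using Nat.le_induction with
    | base =>
        simp only [Finset.range_one, Finset.sum_singleton, Finset.Ico_self, Finset.sum_empty, add_zero,
          zero_add]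
        have h0 := hKG 0 (by omega)
        nlinarith [mul_le_mul_of_nonneg_left h0 hf1]
    | succ n hn ih =>
        have ih' := ih (by omega)
        rw [Finset.sum_range_succ, Finset.sum_Ico_succ_top (by omega : 1 ≤ n)]
        have h1 : f n ≤ f (n + 1) := hfup n hn (by omega)
        have h2 : K n ≤ G n := hKG n (by omega)
        nlinarith [mul_le_mul_of_nonneg_left h2 (sub_nonneg.mpr h1)]
  have h := key m hm le_rfl
  nlinarith [mul_nonneg hfm hKm]

/-- Ascending half: `Σ_{m≤t<n} f(t+1)(K(t+1) − K t) ≤ f n·G n + Σ_{m+1≤t<n} (f t − f(t+1))·G t` for `f ≥ 0` nonincreasing on `[m+1,n]`,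
`0 ≤ K m`, `K ≤ G` on `[m+1,n]`. [folklore] -/
private theorem abel_asc_le (f K G : ℕ → ℝ) (m n : ℕ) (hmn : m + 1 ≤ n)
    (hfn : 0 ≤ f n) (hfm1 : 0 ≤ f (m + 1))
    (hfdown : ∀ t, m + 1 ≤ t → t < n → f (t + 1) ≤ f t)
    (hKm : 0 ≤ K m) (hKG : ∀ t, m + 1 ≤ t → t ≤ n → K t ≤ G t) :
    ∑ t ∈ Finset.Ico m n, f (t + 1) * (K (t + 1) - K t)
      ≤ f n * G n + ∑ t ∈ Finset.Ico (m + 1) n, (f t - f (t + 1)) * G t := by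
  have key : ∀ n', m + 1 ≤ n' → n' ≤ n → ∑ t ∈ Finset.Ico m n', f (t + 1) * (K (t + 1) - K t)
      ≤ f n' * K n' + ∑ t ∈ Finset.Ico (m + 1) n', (f t - f (t + 1)) * G t - f (m + 1) * K m := by
    intro n' hn' hn'n
    induction n', hn' using Nat.le_induction with
    | base =>
        rw [Finset.sum_Ico_succ_top (by omega : m ≤ m), Finset.Ico_self, Finset.Ico_self, Finset.sum_empty,
          Finset.sum_empty]
        nlinarith
    | succ n' hn' ih =>
        have ih' := ih (by omega)
        rw [Finset.sum_Ico_succ_top (by omega : m ≤ n'), Finset.sum_Ico_succ_top (by omega : m + 1 ≤ n')]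
        have h1 : f (n' + 1) ≤ f n' := hfdown n' hn' (by omega)
        have h2 : K n' ≤ G n' := hKG n' hn' (by omega)
        nlinarith [mul_le_mul_of_nonneg_left h2 (sub_nonneg.mpr h1)]
  have h := key n hmn le_rfl
  have h3 : K n ≤ G n := hKG n (by omega) le_rfl
  nlinarith [mul_nonneg hfm1 hKm, mul_le_mul_of_nonneg_left h3 hfn]

/-! ## §2 Cycle bookkeeping -/

variable {n : ℕ} [NeZero n]

/-- Summing a function of `s.val` over `ZMod n` is summing over `range n`. [folklore] -/
private theorem sum_zmod_val_eq_sum_range (F : ℕ → ℝ) : ∑ s : ZMod n, F s.val = ∑ j ∈ Finset.range n, F j := by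
  refine Finset.sum_nbij' (fun s => s.val) (fun j => (j : ZMod n)) ?_ ?_ ?_ ?_ ?_
  · intro s _; exact Finset.mem_range.2 (ZMod.val_lt _)
  · intro j _; exact Finset.mem_univ _
  · intro s _; simp only [ZMod.natCast_zmod_val]
  · intro j hj
    rw [Finset.mem_range] at hj
    simp only [ZMod.val_natCast, Nat.mod_eq_of_lt hj]
  · intro s _; rfl

omit [NeZero n] in
/-- `val` of a small natural cast. [folklore] -/
private theorem val_natCast_of_lt {j : ℕ} (hj : j < n) : ((j : ZMod n)).val = j := by
  rw [ZMod.val_natCast, Nat.mod_eq_of_lt hj]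

/-- The periodic distance of a small natural cast (`j = n` wraps to `0`). [folklore] -/
private theorem circDist_natCast {j : ℕ} (hj : j ≤ n) :
    min ((j : ZMod n)).val (n - ((j : ZMod n)).val) = min j (n - j) := by
  rcases Nat.lt_or_ge j n with h | h
  · rw [val_natCast_of_lt h]
  · have : j = n := le_antisymm hj h
    subst this
    rw [ZMod.natCast_self, ZMod.val_zero]; simp

/-! ## §3 The weighted total variation of a V-shaped profile under an even majorant -/

/-- **WEIGHTED TOTAL VARIATION OF A V-SHAPED PROFILE UNDER AN EVEN MAJORANT (Abel summation on the cycle).**  On `ℤ∕n`, `n ≥ 2`: let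
`H ≥ 0` be even (`H(−s) = H(s)`) and non-increasing in `|s|` on `[1, ⌊n∕2⌋]` (`H(s) ≤ H(s−1)` for `s.val ∈ [1, ⌊n∕2⌋]` — the profile of a symmetric
decreasing kernel), dominated by `S·G` with `G` even; let the longitudinal weight be `φ(d_n(s))`, `d_n(s) = min(s.val, n − s.val)`, with `φ ≥ 0` monotone.
Then `Σ_s φ(d_n(s))·|H(s) − H(s−1)| ≤ S·[(φ0 + φ1)·G(0) + Σ_{1 ≤ j < ⌊n∕2⌋} (φ(j+1) − φ(j−1))·G(j)]` — each half of the V is summed by parts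
against the monotone weight and the increments of `H` are paid by the majorant.  This is the 1-d core of the WEIGHTED ∇-row (P-J-1b) of the pub-balaban NE9
chain's storey J (t4-ne9-idea-1 g129's `weighted_row_core`, steps (2)–(6), Mathlib-only scratch under FREEZE (0); here in the tree).  With `φ ≡ 1` the
right-hand side is `2S·G(0)` (cf. `B5Eq129FreeResolventCycleProfile.sum_abs_sub_eq`'s exact `2(G(0) − G(M))` for the kernel itself).
[folklore] [cite: Balaban1984PropagatorsI, (1.29) p.23] -/
theorem weighted_tv_le (hn : 2 ≤ n) {H G : ZMod n → ℝ} (hHnn : ∀ s, 0 ≤ H s) (hHeven : ∀ s, H (-s) = H s)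
    (hHmono : ∀ s : ZMod n, 1 ≤ s.val → s.val ≤ n / 2 → H s ≤ H (s - 1))
    (hGeven : ∀ s, G (-s) = G s) {S : ℝ} (hHG : ∀ s, H s ≤ S * G s)
    (φ : ℕ → ℝ) (hφ0 : ∀ j, 0 ≤ φ j) (hφ : Monotone φ) :
    ∑ s : ZMod n, φ (min s.val (n - s.val)) * |H s - H (s - 1)| ≤
      S * ((φ 0 + φ 1) * G 0 + ∑ j ∈ Finset.Ico 1 (n / 2), (φ (j + 1) - φ (j - 1)) * G (j : ZMod n)) := by
  classical
  -- letters
  set M : ℕ := n / 2 with hM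
  set M' : ℕ := n - n / 2 with hM'
  have hM1 : 1 ≤ M := by omega
  have hMM' : M ≤ M' := by omega
  have hM'le : M' ≤ M + 1 := by omega
  have hM'P : M' + 1 ≤ n := by omega
  set Kn : ℕ → ℝ := fun j => H (j : ZMod n) with hKn
  set Gn : ℕ → ℝ := fun j => S * G (j : ZMod n) with hGn
  set fn : ℕ → ℝ := fun j => φ (min j (n - j)) with hfn
  -- (2) facts about `H`, `G`, `f` read on `ℕ`
  have hKn_desc : ∀ s, s + 1 ≤ M → Kn (s + 1) ≤ Kn s := by
    intro s hs
    have hlt : s + 1 < n := by omega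
    have h := hHmono ((s + 1 : ℕ) : ZMod n) (by rw [val_natCast_of_lt hlt]; omega) (by rw [val_natCast_of_lt hlt]; omega)
    have e : ((s + 1 : ℕ) : ZMod n) - 1 = ((s : ℕ) : ZMod n) := by push_cast; ring
    rw [e] at h
    exact h
  have hKn_even : ∀ j, j ≤ n → Kn (n - j) = Kn j := by
    intro j hj
    simp only [hKn]
    rw [Nat.cast_sub hj, ZMod.natCast_self, zero_sub, hHeven]
  have hGn_even : ∀ j, j ≤ n → Gn (n - j) = Gn j := by
    intro j hj
    simp only [hGn]
    rw [Nat.cast_sub hj, ZMod.natCast_self, zero_sub, hGeven]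
  have hKn_le : ∀ j, Kn j ≤ Gn j := fun j => hHG _
  have hKn_nn : ∀ j, 0 ≤ Kn j := fun j => hHnn _
  have hdown : ∀ t, t < M' → Kn (t + 1) ≤ Kn t := by
    intro t ht
    by_cases h : t + 1 ≤ M
    · exact hKn_desc t h
    · have htM : t = M := by omega
      have e1 : t + 1 = n - M := by omega
      rw [e1, hKn_even M (by omega), htM]
  have hup : ∀ t, M' ≤ t → t < n → Kn t ≤ Kn (t + 1) := by
    intro t h1 h2
    have e1 : Kn t = Kn (n - t) := by
      rw [← hKn_even (n - t) (by omega)]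
      congr 1; omega
    have e2 : Kn (t + 1) = Kn (n - t - 1) := by
      rw [← hKn_even (n - t - 1) (by omega)]
      congr 1; omega
    have h3 := hKn_desc (n - t - 1) (by omega)
    have e3 : n - t - 1 + 1 = n - t := by omega
    rw [e3] at h3
    rw [e1, e2]
    exact h3
  have hfn_nn : ∀ j, 0 ≤ fn j := fun j => hφ0 _
  have hfn_up : ∀ t, 1 ≤ t → t < M' → fn t ≤ fn (t + 1) := by
    intro t _ h2
    simp only [hfn]
    apply hφ
    rw [Nat.min_eq_left (by omega : t ≤ n - t)]
    rw [Nat.min_def]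
    split_ifs <;> omega
  have hfn_down : ∀ t, M' + 1 ≤ t → t < n → fn (t + 1) ≤ fn t := by
    intro t h1 h2
    simp only [hfn]
    apply hφ
    rw [Nat.min_eq_right (by omega : n - (t + 1) ≤ t + 1), Nat.min_eq_right (by omega : n - t ≤ t)]
    omega
  -- (3) the row read on `range n`
  have hre : ∑ s : ZMod n, φ (min s.val (n - s.val)) * |H s - H (s - 1)|
      = ∑ s : ZMod n, φ (min (s + 1).val (n - (s + 1).val)) * |H (s + 1) - H s| := by
    rw [← Equiv.sum_comp (Equiv.addRight (1 : ZMod n))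
      (fun s => φ (min s.val (n - s.val)) * |H s - H (s - 1)|)]
    simp
  have hval : ∀ s : ZMod n, φ (min (s + 1).val (n - (s + 1).val)) * |H (s + 1) - H s|
      = fn (s.val + 1) * |Kn (s.val + 1) - Kn s.val| := by
    intro s
    have hs := ZMod.val_lt s
    have hsucc : s + 1 = ((s.val + 1 : ℕ) : ZMod n) := by push_cast; rw [ZMod.natCast_zmod_val]
    have hs' : s = ((s.val : ℕ) : ZMod n) := (ZMod.natCast_zmod_val s).symm
    simp only [hfn, hKn]
    rw [hsucc, circDist_natCast (by omega : s.val + 1 ≤ n), ← hs']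
  have hsumN : ∑ s : ZMod n, φ (min (s + 1).val (n - (s + 1).val)) * |H (s + 1) - H s|
      = ∑ j ∈ Finset.range n, fn (j + 1) * |Kn (j + 1) - Kn j| := by
    rw [Finset.sum_congr rfl (fun s _ => hval s)]
    exact sum_zmod_val_eq_sum_range (fun j => fn (j + 1) * |Kn (j + 1) - Kn j|)
  have hsplit : ∑ j ∈ Finset.range n, fn (j + 1) * |Kn (j + 1) - Kn j|
      = ∑ j ∈ Finset.range M', fn (j + 1) * (Kn j - Kn (j + 1))
        + ∑ j ∈ Finset.Ico M' n, fn (j + 1) * (Kn (j + 1) - Kn j) := by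
    rw [Finset.range_eq_Ico, ← Finset.sum_Ico_consecutive _ (Nat.zero_le M') (by omega : M' ≤ n),
      ← Finset.range_eq_Ico]
    congr 1
    · refine Finset.sum_congr rfl (fun j hj => ?_)
      rw [Finset.mem_range] at hj
      rw [abs_of_nonpos (by linarith [hdown j hj])]
      ring
    · refine Finset.sum_congr rfl (fun j hj => ?_)
      rw [Finset.mem_Ico] at hj
      rw [abs_of_nonneg (by linarith [hup j hj.1 hj.2])]
  -- (4) Abel summation on both halves
  have hA := abel_desc_le fn Kn Gn M' (by omega) (hfn_nn 1) (hfn_nn M') hfn_up (hKn_nn M')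
    (fun t _ => hKn_le t)
  have hB := abel_asc_le fn Kn Gn M' n hM'P (hfn_nn n) (hfn_nn (M' + 1)) hfn_down (hKn_nn M')
    (fun t _ _ => hKn_le t)
  -- (5) evaluation of the right-hand sides
  have hfn1 : fn 1 = φ 1 := by
    simp only [hfn]; rw [Nat.min_eq_left (by omega : 1 ≤ n - 1)]
  have hfnP : fn n = φ 0 := by
    simp only [hfn]; rw [Nat.sub_self, Nat.min_eq_right (Nat.zero_le _)]
  have hGnP : Gn n = S * G 0 := by simp only [hGn]; rw [ZMod.natCast_self]
  have hGn0 : Gn 0 = S * G 0 := by simp only [hGn]; rw [Nat.cast_zero]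
  have hmid1 : ∑ t ∈ Finset.Ico 1 M', (fn (t + 1) - fn t) * Gn t
      = ∑ j ∈ Finset.Ico 1 M, (φ (j + 1) - φ j) * (S * G (j : ZMod n)) := by
    have hterm : ∀ t, t ∈ Finset.Ico 1 M → (fn (t + 1) - fn t) * Gn t = (φ (t + 1) - φ t) * (S * G (t : ZMod n)) := by
      intro t ht
      rw [Finset.mem_Ico] at ht
      simp only [hfn, hGn]
      rw [Nat.min_eq_left (by omega : t + 1 ≤ n - (t + 1)), Nat.min_eq_left (by omega : t ≤ n - t)]
    rcases (by omega : M' = M ∨ M' = M + 1) with h | h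
    · rw [h]
      exact Finset.sum_congr rfl hterm
    · rw [h, Finset.sum_Ico_succ_top hM1, Finset.sum_congr rfl hterm]
      have hzero : (fn (M + 1) - fn M) * Gn M = 0 := by
        simp only [hfn]
        have e1 : min (M + 1) (n - (M + 1)) = M := by
          rw [Nat.min_eq_right (by omega : n - (M + 1) ≤ M + 1)]; omega
        have e2 : min M (n - M) = M := Nat.min_eq_left (by omega)
        rw [e1, e2]; ring
      rw [hzero, add_zero]
  have hmid2 : ∑ t ∈ Finset.Ico (M' + 1) n, (fn t - fn (t + 1)) * Gn t
      = ∑ j ∈ Finset.Ico 1 M, (φ j - φ (j - 1)) * (S * G (j : ZMod n)) := by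
    have hrefl := Finset.sum_Ico_reflect (fun t => (fn t - fn (t + 1)) * Gn t) 1 (m := M) (n := n)
      (by omega : M ≤ n + 1)
    have e1 : n + 1 - M = M' + 1 := by omega
    have e2 : n + 1 - 1 = n := by omega
    rw [e1, e2] at hrefl
    rw [← hrefl]
    refine Finset.sum_congr rfl (fun j hj => ?_)
    rw [Finset.mem_Ico] at hj
    have hs1 : min (n - j) (n - (n - j)) = j := by
      rw [Nat.min_eq_right (by omega : n - (n - j) ≤ n - j)]; omega
    have hs2 : min (n - j + 1) (n - (n - j + 1)) = j - 1 := by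
      rw [Nat.min_eq_right (by omega : n - (n - j + 1) ≤ n - j + 1)]; omega
    have hG' : Gn (n - j) = S * G (j : ZMod n) := by
      rw [hGn_even j (by omega)]
    simp only [hfn] at hG' ⊢
    rw [hs1, hs2, hG']
  have hcomb : ∑ j ∈ Finset.Ico 1 M, (φ (j + 1) - φ j) * (S * G (j : ZMod n))
      + ∑ j ∈ Finset.Ico 1 M, (φ j - φ (j - 1)) * (S * G (j : ZMod n))
      = S * ∑ j ∈ Finset.Ico 1 M, (φ (j + 1) - φ (j - 1)) * G (j : ZMod n) := by
    rw [← Finset.sum_add_distrib, Finset.mul_sum]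
    exact Finset.sum_congr rfl (fun j _ => by ring)
  -- (6) assembly
  rw [hre, hsumN, hsplit]
  calc ∑ j ∈ Finset.range M', fn (j + 1) * (Kn j - Kn (j + 1)) + ∑ j ∈ Finset.Ico M' n, fn (j + 1) * (Kn (j + 1) - Kn j)
      ≤ (fn 1 * Gn 0 + ∑ t ∈ Finset.Ico 1 M', (fn (t + 1) - fn t) * Gn t)
        + (fn n * Gn n + ∑ t ∈ Finset.Ico (M' + 1) n, (fn t - fn (t + 1)) * Gn t) := add_le_add hA hB
    _ = S * ((φ 0 + φ 1) * G 0 + ∑ j ∈ Finset.Ico 1 (n / 2), (φ (j + 1) - φ (j - 1)) * G (j : ZMod n)) := by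
        rw [hmid1, hmid2, hfn1, hfnP, hGnP, hGn0]
        linear_combination hcomb

end Literature.MathematicalPhysics.QuantumFieldTheory.Balaban1983to89.B5Eq129FreeResolventCycleWeightedTV

end
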